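import Summits.RiemannHypothesis.RiemannHypothesis.Theorems.SoloInformedGroundStateBootstrap

/-!
# Ground-state endgame, V-c: visibility of the ground state decides the Riemann hypothesis

Solo programme `solo-RiemannHypothesis-informed`, session 3 (part 3 of the operator-free endgame).
Everything here is proved, with no named fact as hypothesis: in particular NO input from
Connes–van Suijlekom (simplicity / evenness of the bottom of the Weil form, real zeros of the ground
state), no convergence `k̂ → Ξ`, no Hurwitz theorem, and no rate.

With `E(a) = e^{a/2}√(2a)` and the `ℓ¹` zero sum `Z₁(k; T) = Σ_{0<|Im ρ|≤T} m(ρ)|k̂(ρ)|`, the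
bootstrap of part 2 gives, for a ground state `u` of the window `[-a, a]` (or merely a normalised
near-minimiser `g`) within `L²`-distance `√δ < 1` of a window test `k` with `Z₁(k; ·) ≤ A`:
`ε(a) ≥ −4 A E(a)/(1 − δ)` (`weilGroundEnergy_ge_of_visible`,
`weilGroundEnergy_ge_of_visible_near_minimiser`).  Fed into the exponential-slack Weil criterion
(`riemannHypothesis_of_weilGroundEnergy_subexp`,
`abs_re_sub_half_le_of_weilGroundEnergy_exp_lower`):

* `abs_re_sub_half_le_of_visible_groundStates` — if for all large `a` the ground state is visible
  (`‖u_a − k_a‖₂² ≤ δ < 1`) from a window test with `Z₁(k_a) E(a) ≤ B e^{κ a}`, every non-trivial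
  zero has `|Re ρ − 1/2| ≤ κ/2`;
* `riemannHypothesis_of_visible_groundStates_subexp` — if this holds for every `κ > 0` (only
  SUBEXPONENTIAL growth of `Z₁(k_a) E(a)` is asked), the Riemann hypothesis follows; bounded case
  `riemannHypothesis_of_visible_groundStates`, summit form `summit_of_visible_groundStates`;
* `riemannHypothesis_of_visible_near_minimisers(_subexp)` — the same with normalised
  near-minimisers `g_a`, `Re Q(g_a) ≤ ε(a) + s_a`, in place of ground states: no `L²` limit at all.

Compare `riemannHypothesis_of_L2_tracking` (session 2), which needed
`e^{α a}√(2a)‖c u_a − k_a‖₂ → 0` for every `α < 1/2` AND the Connes–van Suijlekom input: here the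
ground state only has to be *visible* — not asymptotically orthogonal — from the explicit near-null
vectors of the zero pairing.  By `one_sub_le_dist_sq_of_weilGroundEnergy_neg` (part 2) this is
also necessary in the presence of an off-line zero.  The remaining, Riemann-hypothesis-hard, input
is thus isolated as ONE inequality: `limsup_a inf_k ‖u_a − k‖₂ < 1` over window tests `k` with
`Z₁(k) E(a) = e^{o(a)}`.
-/

noncomputable section

open Complex Filter Set Topology Metric MeasureTheory
open Literature.NumberTheory.LFunctions
open scoped ComplexConjugate

namespace Summit.RiemannHypothesis.RiemannHypothesis.Theorems

/-! ## (O) The endgame: visible ground states decide RH -/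

section Endgame

variable {u k : ℝ → ℂ} {a A δ : ℝ}

/-- `‖k‖₂ ≤ ‖u‖₂ + ‖u − k‖₂ = 1 + ‖u − k‖₂` for a normalised `u ∈ L²`. -/
theorem sqrt_integral_norm_sq_le_one_add (hu : MemLp u 2) (hu1 : ∫ t, ‖u t‖ ^ 2 = 1)
    (hk : MemLp k 2) :
    Real.sqrt (∫ t, ‖k t‖ ^ 2) ≤ 1 + Real.sqrt (∫ t, ‖u t - k t‖ ^ 2) := by
  have h := sqrt_integral_norm_sq_sub_le hu (hu.sub hk)
  simp only [Pi.sub_apply, sub_sub_cancel] at h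
  rwa [hu1, Real.sqrt_one] at h

/-- **One visible window.** If `‖u − k‖₂² ≤ δ < 1` for a ground state `u` and a window test `k`
with `Z₁(k; ·) ≤ A`, then `ε(a) ≥ −4 A e^{a/2}√(2a)/(1 − δ)`. -/
theorem weilGroundEnergy_ge_of_visible (hδ : δ < 1) (hu : IsWeilGroundState a u)
    (hk : IsWeilTest k) (hks : tsupport k ⊆ Icc (-a) a) (hA : ∀ T : ℝ,
      ∑ᶠ ρ ∈ weilZeroIndex T, (riemannZetaZeroOrder ρ : ℝ) * ‖weilMellin k ρ‖ ≤ A)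
    (hΔ : ∫ t, ‖u t - k t‖ ^ 2 ≤ δ) :
    -(4 * (A * (Real.exp (a / 2) * Real.sqrt (2 * a))) / (1 - δ)) ≤ weilGroundEnergy a := by
  have hD1 : ∫ t, ‖u t - k t‖ ^ 2 < 1 := hΔ.trans_lt hδ
  have key := weilGroundEnergy_ge_of_groundState hu hk hks hA hD1
  have hA0 : 0 ≤ A := (zeroSumAbs_nonneg k 0).trans (hA 0)
  set X : ℝ := A * (Real.exp (a / 2) * Real.sqrt (2 * a)) with hX
  have hX0 : 0 ≤ X := by positivity
  have hkm : MemLp k 2 := hk.1.continuous.memLp_of_hasCompactSupport hk.2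
  have hk2 := sqrt_integral_norm_sq_le_one_add hu.memLp hu.integral_norm_sq hkm
  have hΔ1 : Real.sqrt (∫ t, ‖u t - k t‖ ^ 2) ≤ 1 := by
    rw [← Real.sqrt_one]
    exact Real.sqrt_le_sqrt hD1.le
  have hN : Real.sqrt (∫ t, ‖k t‖ ^ 2) + 2 * Real.sqrt (∫ t, ‖u t - k t‖ ^ 2) ≤ 4 := by linarith
  have hN0 : 0 ≤ Real.sqrt (∫ t, ‖k t‖ ^ 2) + 2 * Real.sqrt (∫ t, ‖u t - k t‖ ^ 2) := by positivity
  have hpos : 0 < 1 - ∫ t, ‖u t - k t‖ ^ 2 := sub_pos.2 hD1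
  have hposδ : 0 < 1 - δ := sub_pos.2 hδ
  have hcmp : X * (Real.sqrt (∫ t, ‖k t‖ ^ 2) + 2 * Real.sqrt (∫ t, ‖u t - k t‖ ^ 2)) /
      (1 - ∫ t, ‖u t - k t‖ ^ 2) ≤ 4 * X / (1 - δ) := by
    rw [div_le_div_iff₀ hpos hposδ]
    have h1 : X * (Real.sqrt (∫ t, ‖k t‖ ^ 2) + 2 * Real.sqrt (∫ t, ‖u t - k t‖ ^ 2)) ≤ 4 * X := by
      nlinarith
    have h2 : 1 - δ ≤ 1 - ∫ t, ‖u t - k t‖ ^ 2 := by linarith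
    calc X * (Real.sqrt (∫ t, ‖k t‖ ^ 2) + 2 * Real.sqrt (∫ t, ‖u t - k t‖ ^ 2)) * (1 - δ)
        ≤ 4 * X * (1 - δ) := mul_le_mul_of_nonneg_right h1 hposδ.le
      _ ≤ 4 * X * (1 - ∫ t, ‖u t - k t‖ ^ 2) := mul_le_mul_of_nonneg_left h2 (by positivity)
  linarith

/-- **Zero-free strip from visible ground states (the thermometer, operator-free).** Let
`0 ≤ κ`, `δ < 1`.  Suppose that for every `a ≥ a₀` there are a ground state `u` of `[-a, a]`, a test
`k` on `[-a, a]` and `A` with `Z₁(k; ·) ≤ A`, `A e^{a/2}√(2a) ≤ B e^{κ a}` and `‖u − k‖₂² ≤ δ`.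
Then every non-trivial zero of `ζ` satisfies `|Re ρ − 1/2| ≤ κ/2`. -/
theorem abs_re_sub_half_le_of_visible_groundStates {κ B a₀ : ℝ} (hκ : 0 ≤ κ) (hδ : δ < 1)
    (H : ∀ a : ℝ, a₀ ≤ a → ∃ (u k : ℝ → ℂ) (A : ℝ), IsWeilGroundState a u ∧ IsWeilTest k ∧
      tsupport k ⊆ Icc (-a) a ∧
      (∀ T : ℝ, ∑ᶠ ρ ∈ weilZeroIndex T, (riemannZetaZeroOrder ρ : ℝ) * ‖weilMellin k ρ‖ ≤ A) ∧
      A * (Real.exp (a / 2) * Real.sqrt (2 * a)) ≤ B * Real.exp (κ * a) ∧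
      ∫ t, ‖u t - k t‖ ^ 2 ≤ δ)
    {ρ : ℂ} (hρ : ρ ∈ ZetaZeros.riemannZetaNontrivialZeros) : |ρ.re - 1 / 2| ≤ κ / 2 := by
  have hposδ : 0 < 1 - δ := sub_pos.2 hδ
  refine abs_re_sub_half_le_of_weilGroundEnergy_exp_lower (C := 4 * B / (1 - δ)) (a₀ := a₀) hκ
    (fun a ha ↦ ?_) hρ
  obtain ⟨u, k, A, hu, hk, hks, hA, hAB, hΔ⟩ := H a ha
  have key := weilGroundEnergy_ge_of_visible hδ hu hk hks hA hΔ
  have hcmp : 4 * (A * (Real.exp (a / 2) * Real.sqrt (2 * a))) / (1 - δ) ≤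
      4 * B / (1 - δ) * Real.exp (κ * a) := by
    rw [div_mul_eq_mul_div, div_le_div_iff_of_pos_right hposδ]
    nlinarith
  linarith

/-- **The Riemann hypothesis from visible ground states (subexponential form).**  Let `δ < 1`.
Suppose that for every `κ > 0` there are `B, a₀` such that every window `a ≥ a₀` carries a ground
state `u`, a test `k` on the window and `A` with `Z₁(k; ·) ≤ A`, `A e^{a/2}√(2a) ≤ B e^{κ a}` and
`‖u − k‖₂² ≤ δ`.  Then `RiemannHypothesis` holds.  No rate, no operator theory, no convergence to
`Ξ`: only VISIBILITY (`‖u_a − k_a‖₂ ≤ √δ < 1`) of the ground states from near-null vectors of the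
zero pairing whose `ℓ¹` zero sum grows subexponentially against `E(a)`. -/
theorem riemannHypothesis_of_visible_groundStates_subexp (hδ : δ < 1)
    (H : ∀ κ : ℝ, 0 < κ → ∃ B a₀ : ℝ, ∀ a : ℝ, a₀ ≤ a → ∃ (u k : ℝ → ℂ) (A : ℝ),
      IsWeilGroundState a u ∧ IsWeilTest k ∧ tsupport k ⊆ Icc (-a) a ∧
      (∀ T : ℝ, ∑ᶠ ρ ∈ weilZeroIndex T, (riemannZetaZeroOrder ρ : ℝ) * ‖weilMellin k ρ‖ ≤ A) ∧
      A * (Real.exp (a / 2) * Real.sqrt (2 * a)) ≤ B * Real.exp (κ * a) ∧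
      ∫ t, ‖u t - k t‖ ^ 2 ≤ δ) :
    RiemannHypothesis := by
  have hposδ : 0 < 1 - δ := sub_pos.2 hδ
  refine riemannHypothesis_of_weilGroundEnergy_subexp fun κ hκ ↦ ?_
  obtain ⟨B, a₀, hB⟩ := H κ hκ
  refine ⟨4 * B / (1 - δ), a₀, fun a ha ↦ ?_⟩
  obtain ⟨u, k, A, hu, hk, hks, hA, hAB, hΔ⟩ := hB a ha
  have key := weilGroundEnergy_ge_of_visible hδ hu hk hks hA hΔ
  have hcmp : 4 * (A * (Real.exp (a / 2) * Real.sqrt (2 * a))) / (1 - δ) ≤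
      4 * B / (1 - δ) * Real.exp (κ * a) := by
    rw [div_mul_eq_mul_div, div_le_div_iff_of_pos_right hposδ]
    nlinarith
  linarith

/-- **The Riemann hypothesis from visible ground states (bounded form).**  If `δ < 1` and for every
`a ≥ a₀` there are a ground state `u` of the window `[-a, a]`, a test `k` on the window and `A` with
`Z₁(k; ·) ≤ A`, `A e^{a/2}√(2a) ≤ B` and `‖u − k‖₂² ≤ δ`, then `RiemannHypothesis` holds. -/
theorem riemannHypothesis_of_visible_groundStates {B a₀ : ℝ} (hδ : δ < 1)
    (H : ∀ a : ℝ, a₀ ≤ a → ∃ (u k : ℝ → ℂ) (A : ℝ), IsWeilGroundState a u ∧ IsWeilTest k ∧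
      tsupport k ⊆ Icc (-a) a ∧
      (∀ T : ℝ, ∑ᶠ ρ ∈ weilZeroIndex T, (riemannZetaZeroOrder ρ : ℝ) * ‖weilMellin k ρ‖ ≤ A) ∧
      A * (Real.exp (a / 2) * Real.sqrt (2 * a)) ≤ B ∧ ∫ t, ‖u t - k t‖ ^ 2 ≤ δ) :
    RiemannHypothesis := by
  refine riemannHypothesis_of_visible_groundStates_subexp hδ fun κ hκ ↦
    ⟨max B 0, a₀, fun a ha ↦ ?_⟩
  obtain ⟨u, k, A, hu, hk, hks, hA, hAB, hΔ⟩ := H a ha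
  have hapos := hu.pos
  have hexp : 1 ≤ Real.exp (κ * a) := Real.one_le_exp (by positivity)
  refine ⟨u, k, A, hu, hk, hks, hA, ?_, hΔ⟩
  calc A * (Real.exp (a / 2) * Real.sqrt (2 * a)) ≤ max B 0 := hAB.trans (le_max_left _ _)
    _ = max B 0 * 1 := (mul_one _).symm
    _ ≤ max B 0 * Real.exp (κ * a) := mul_le_mul_of_nonneg_left hexp (le_max_right _ _)

/-- Summit form of `riemannHypothesis_of_visible_groundStates`. -/
theorem summit_of_visible_groundStates {B a₀ : ℝ} (hδ : δ < 1)
    (H : ∀ a : ℝ, a₀ ≤ a → ∃ (u k : ℝ → ℂ) (A : ℝ), IsWeilGroundState a u ∧ IsWeilTest k ∧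
      tsupport k ⊆ Icc (-a) a ∧
      (∀ T : ℝ, ∑ᶠ ρ ∈ weilZeroIndex T, (riemannZetaZeroOrder ρ : ℝ) * ‖weilMellin k ρ‖ ≤ A) ∧
      A * (Real.exp (a / 2) * Real.sqrt (2 * a)) ≤ B ∧ ∫ t, ‖u t - k t‖ ^ 2 ≤ δ) :
    Summit.RiemannHypothesis :=
  riemannHypothesis_of_visible_groundStates hδ H

/-- **One visible window, near-minimiser form (no ground state needed).** `g` a normalised test
on `[-a, a]` with `Re Q(g) ≤ ε(a) + s` (`s ≥ 0`), `k` a window test with `Z₁(k; ·) ≤ A` and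
`‖g − k‖₂² ≤ δ < 1`: then `ε(a) ≥ −(4 A e^{a/2}√(2a) + s)/(1 − δ)`. -/
theorem weilGroundEnergy_ge_of_visible_near_minimiser {g : ℝ → ℂ} (hδ : δ < 1) (ha : 0 ≤ a)
    (hg : IsWeilTest g) (hgs : tsupport g ⊆ Icc (-a) a) (hg1 : ∫ t, ‖g t‖ ^ 2 = 1) {s : ℝ}
    (hs : 0 ≤ s) (hgap : (weilQuadratic g).re ≤ weilGroundEnergy a + s) (hk : IsWeilTest k)
    (hks : tsupport k ⊆ Icc (-a) a) (hA : ∀ T : ℝ,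
      ∑ᶠ ρ ∈ weilZeroIndex T, (riemannZetaZeroOrder ρ : ℝ) * ‖weilMellin k ρ‖ ≤ A)
    (hΔ : ∫ t, ‖g t - k t‖ ^ 2 ≤ δ) :
    -((4 * (A * (Real.exp (a / 2) * Real.sqrt (2 * a))) + s) / (1 - δ)) ≤ weilGroundEnergy a := by
  have hD1 : ∫ t, ‖g t - k t‖ ^ 2 < 1 := hΔ.trans_lt hδ
  have key := weilGroundEnergy_ge_of_near_minimiser hg hgs ha hgap hk hks hA hD1
  have hA0 : 0 ≤ A := (zeroSumAbs_nonneg k 0).trans (hA 0)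
  set X : ℝ := A * (Real.exp (a / 2) * Real.sqrt (2 * a)) with hX
  have hX0 : 0 ≤ X := by positivity
  have hgm : MemLp g 2 := hg.1.continuous.memLp_of_hasCompactSupport hg.2
  have hkm : MemLp k 2 := hk.1.continuous.memLp_of_hasCompactSupport hk.2
  have hk2 := sqrt_integral_norm_sq_le_one_add hgm hg1 hkm
  have hΔ1 : Real.sqrt (∫ t, ‖g t - k t‖ ^ 2) ≤ 1 := by
    rw [← Real.sqrt_one]
    exact Real.sqrt_le_sqrt hD1.le
  have hN : Real.sqrt (∫ t, ‖k t‖ ^ 2) + 2 * Real.sqrt (∫ t, ‖g t - k t‖ ^ 2) ≤ 4 := by linarith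
  have hN0 : 0 ≤ Real.sqrt (∫ t, ‖k t‖ ^ 2) + 2 * Real.sqrt (∫ t, ‖g t - k t‖ ^ 2) := by
    positivity
  have hpos : 0 < 1 - ∫ t, ‖g t - k t‖ ^ 2 := sub_pos.2 hD1
  have hposδ : 0 < 1 - δ := sub_pos.2 hδ
  have hcmp : (X * (Real.sqrt (∫ t, ‖k t‖ ^ 2) + 2 * Real.sqrt (∫ t, ‖g t - k t‖ ^ 2)) + s) /
      (1 - ∫ t, ‖g t - k t‖ ^ 2) ≤ (4 * X + s) / (1 - δ) := by
    rw [div_le_div_iff₀ hpos hposδ]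
    have h1 : X * (Real.sqrt (∫ t, ‖k t‖ ^ 2) + 2 * Real.sqrt (∫ t, ‖g t - k t‖ ^ 2)) + s ≤
        4 * X + s := by nlinarith
    have h2 : 1 - δ ≤ 1 - ∫ t, ‖g t - k t‖ ^ 2 := by linarith
    have h3 : 0 ≤ 4 * X + s := by positivity
    calc (X * (Real.sqrt (∫ t, ‖k t‖ ^ 2) + 2 * Real.sqrt (∫ t, ‖g t - k t‖ ^ 2)) + s) * (1 - δ)
        ≤ (4 * X + s) * (1 - δ) := mul_le_mul_of_nonneg_right h1 hposδ.le
      _ ≤ (4 * X + s) * (1 - ∫ t, ‖g t - k t‖ ^ 2) := mul_le_mul_of_nonneg_left h2 h3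
  linarith

/-- **The Riemann hypothesis from visible near-minimisers (subexponential form)** — the most
elementary version: no ground state, no `L²` limit, no operator.  Let `δ < 1`.  Suppose that for
every `κ > 0` there are `B, a₀` such that for every `a ≥ a₀` there are a normalised test `g` on
`[-a, a]` and `s ≥ 0` with `Re Q(g) ≤ ε(a) + s`, a window test `k` and `A` with `Z₁(k; ·) ≤ A`,
`4 A e^{a/2}√(2a) + s ≤ B e^{κ a}` and `‖g − k‖₂² ≤ δ`.  Then `RiemannHypothesis`. -/
theorem riemannHypothesis_of_visible_near_minimisers_subexp (hδ : δ < 1)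
    (H : ∀ κ : ℝ, 0 < κ → ∃ B a₀ : ℝ, ∀ a : ℝ, a₀ ≤ a → ∃ (g k : ℝ → ℂ) (A s : ℝ),
      IsWeilTest g ∧ tsupport g ⊆ Icc (-a) a ∧ ∫ t, ‖g t‖ ^ 2 = 1 ∧ 0 ≤ s ∧
      (weilQuadratic g).re ≤ weilGroundEnergy a + s ∧ IsWeilTest k ∧ tsupport k ⊆ Icc (-a) a ∧
      (∀ T : ℝ, ∑ᶠ ρ ∈ weilZeroIndex T, (riemannZetaZeroOrder ρ : ℝ) * ‖weilMellin k ρ‖ ≤ A) ∧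
      4 * (A * (Real.exp (a / 2) * Real.sqrt (2 * a))) + s ≤ B * Real.exp (κ * a) ∧
      ∫ t, ‖g t - k t‖ ^ 2 ≤ δ) :
    RiemannHypothesis := by
  have hposδ : 0 < 1 - δ := sub_pos.2 hδ
  refine riemannHypothesis_of_weilGroundEnergy_subexp fun κ hκ ↦ ?_
  obtain ⟨B, a₀, hB⟩ := H κ hκ
  refine ⟨B / (1 - δ), max a₀ 0, fun a ha ↦ ?_⟩
  obtain ⟨g, k, A, s, hg, hgs, hg1, hs, hgap, hk, hks, hA, hAB, hΔ⟩ :=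
    hB a ((le_max_left _ _).trans ha)
  have ha0 : 0 ≤ a := (le_max_right _ _).trans ha
  have key := weilGroundEnergy_ge_of_visible_near_minimiser hδ ha0 hg hgs hg1 hs hgap hk hks hA hΔ
  have hcmp : (4 * (A * (Real.exp (a / 2) * Real.sqrt (2 * a))) + s) / (1 - δ) ≤
      B / (1 - δ) * Real.exp (κ * a) := by
    rw [div_mul_eq_mul_div, div_le_div_iff_of_pos_right hposδ]
    exact hAB
  linarith

/-- **The Riemann hypothesis from visible near-minimisers (bounded form).**  If `δ < 1` and for
every `a ≥ a₀` there are a normalised test `g` on `[-a, a]` with `Re Q(g) ≤ ε(a) + s`, `s ≥ 0`, a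
window test `k` and `A` with `Z₁(k; ·) ≤ A`, `4 A e^{a/2}√(2a) + s ≤ B` and `‖g − k‖₂² ≤ δ`, then
`RiemannHypothesis`. -/
theorem riemannHypothesis_of_visible_near_minimisers {B a₀ : ℝ} (hδ : δ < 1)
    (H : ∀ a : ℝ, a₀ ≤ a → ∃ (g k : ℝ → ℂ) (A s : ℝ), IsWeilTest g ∧ tsupport g ⊆ Icc (-a) a ∧
      ∫ t, ‖g t‖ ^ 2 = 1 ∧ 0 ≤ s ∧ (weilQuadratic g).re ≤ weilGroundEnergy a + s ∧
      IsWeilTest k ∧ tsupport k ⊆ Icc (-a) a ∧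
      (∀ T : ℝ, ∑ᶠ ρ ∈ weilZeroIndex T, (riemannZetaZeroOrder ρ : ℝ) * ‖weilMellin k ρ‖ ≤ A) ∧
      4 * (A * (Real.exp (a / 2) * Real.sqrt (2 * a))) + s ≤ B ∧ ∫ t, ‖g t - k t‖ ^ 2 ≤ δ) :
    RiemannHypothesis := by
  refine riemannHypothesis_of_visible_near_minimisers_subexp hδ fun κ hκ ↦
    ⟨max B 0, max a₀ 0, fun a ha ↦ ?_⟩
  obtain ⟨g, k, A, s, hg, hgs, hg1, hs, hgap, hk, hks, hA, hAB, hΔ⟩ :=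
    H a ((le_max_left _ _).trans ha)
  have ha0 : 0 ≤ a := (le_max_right _ _).trans ha
  have hexp : 1 ≤ Real.exp (κ * a) := Real.one_le_exp (by positivity)
  refine ⟨g, k, A, s, hg, hgs, hg1, hs, hgap, hk, hks, hA, ?_, hΔ⟩
  calc 4 * (A * (Real.exp (a / 2) * Real.sqrt (2 * a))) + s
      ≤ max B 0 := hAB.trans (le_max_left _ _)
    _ = max B 0 * 1 := (mul_one _).symm
    _ ≤ max B 0 * Real.exp (κ * a) := mul_le_mul_of_nonneg_left hexp (le_max_right _ _)

/-- Summit form of `riemannHypothesis_of_visible_near_minimisers`. -/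
theorem summit_of_visible_near_minimisers {B a₀ : ℝ} (hδ : δ < 1)
    (H : ∀ a : ℝ, a₀ ≤ a → ∃ (g k : ℝ → ℂ) (A s : ℝ), IsWeilTest g ∧ tsupport g ⊆ Icc (-a) a ∧
      ∫ t, ‖g t‖ ^ 2 = 1 ∧ 0 ≤ s ∧ (weilQuadratic g).re ≤ weilGroundEnergy a + s ∧
      IsWeilTest k ∧ tsupport k ⊆ Icc (-a) a ∧
      (∀ T : ℝ, ∑ᶠ ρ ∈ weilZeroIndex T, (riemannZetaZeroOrder ρ : ℝ) * ‖weilMellin k ρ‖ ≤ A) ∧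
      4 * (A * (Real.exp (a / 2) * Real.sqrt (2 * a))) + s ≤ B ∧ ∫ t, ‖g t - k t‖ ^ 2 ≤ δ) :
    Summit.RiemannHypothesis :=
  riemannHypothesis_of_visible_near_minimisers hδ H

end Endgame

end Summit.RiemannHypothesis.RiemannHypothesis.Theorems
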